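import Mathlib
import Summits.Ventures.PercRepro2.Defs
import Summits.Ventures.PercRepro2.Harris
import Summits.Ventures.PercRepro2.Graph
import Summits.Ventures.PercRepro2.Induced
import Summits.Ventures.PercRepro2.VdBKahn

/-!
# Nested avoidance for two INDEPENDENT clusters of one root (blind cell PercRepro2, mine-1 g9;
MINE-1.md §25.8, proofs/MINE1-IID-UNION.md §4)

Two independent Bernoulli(`p`) configurations `ω, ω'` of the same finite graph, the clusters
`C = C_ω(s)`, `C' = C_{ω'}(s)` of a root `s`, vertices `x, y`, and vertex sets `X ⊆ Y`. With
`σ_v = 1[v ∈ C] − 1[v ∈ C']` and the avoidance events `R_X = {C ∩ X = ∅}`, `R'_Y = {C' ∩ Y = ∅}`: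

  `nestIID = Σ_{ω,ω'} w(ω) w(ω') 1_{R_X}(ω) 1_{R'_Y}(ω') σ_x σ_y ≥ 0`.

This is the weighted (all-`p`) form of the cell's row 2′NEST (`AvoidSameSide.lean`, where the
second copy is the COMPLEMENT of the first). Proof: expanding over the two copies,
`nestIID = P_{xy} Q_∅ + P_∅ Q_{xy} − P_x Q_y − P_y Q_x` with `P_S = P(S ⊆ C, R_X)`,
`Q_S = P(S ⊆ C, R_Y)`; van den Berg–Kahn (`vdBK`) gives `P_x P_y ≤ P_{xy} P_∅`, `Q_x Q_y ≤ Q_{xy} Q_∅`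
(conditional positive association) and `Q_x P_∅ ≤ P_x Q_∅`, `Q_y P_∅ ≤ P_y Q_∅` (monotonicity in the
avoided set, `X ⊆ Y`), and then
`nestIID · P_∅ Q_∅ ≥ (P_x Q_∅ − P_∅ Q_x)(P_y Q_∅ − P_∅ Q_y) ≥ 0`.
-/

namespace Summit.Ventures.PercRepro2

section NestIID

variable {V : Type*} {E : Type*} [Fintype E] [DecidableEq E] [Fintype V] [DecidableEq V]
  {R : Type*} [CommRing R] [LinearOrder R] [IsStrictOrderedRing R]

open scoped Classical in
/-- The indicator `1[s ↔ x]` as an observable. -/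
noncomputable def connInd (ends : E → Sym2 V) (s x : V) (ω : Config E) : R :=
  if Conn ends ω s x then 1 else 0

open scoped Classical in
/-- The indicator of the avoidance event `R_X = {s ↮ x ∀ x ∈ X}`. -/
noncomputable def avoidInd (ends : E → Sym2 V) (s : V) (X : Finset V) (ω : Config E) : R :=
  if ω ∈ avoidAll ends s X then 1 else 0

/-- The two-copy nested avoidance sum
`Σ_{ω,ω'} w(ω) w(ω') 1_{R_X}(ω) 1_{R_Y}(ω') (1[x∈C] − 1[x∈C'])(1[y∈C] − 1[y∈C'])`. -/
noncomputable def nestIID (p : E → R) (ends : E → Sym2 V) (s x y : V) (X Y : Finset V) : R :=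
  ∑ ω : Config E, ∑ ω' : Config E,
    weight p ω * weight p ω' * avoidInd ends s X ω * avoidInd ends s Y ω' *
      ((connInd ends s x ω - connInd ends s x ω') * (connInd ends s y ω - connInd ends s y ω'))

variable (p : E → R) (ends : E → Sym2 V) (s : V)


omit [LinearOrder R] [IsStrictOrderedRing R] in
/-- A one-copy sum with connection indicators is a probability. -/
lemma sum_weight_avoid_conn (X S : Finset V) :
    ∑ ω : Config E, weight p ω * avoidInd ends s X ω * ∏ v ∈ S, connInd ends s v ω =
      prob p (connAll ends s S ∩ avoidAll ends s X) := by
  classical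
  unfold prob
  refine Finset.sum_congr rfl fun ω _ => ?_
  rw [Set.indicator_apply]
  simp only [connInd, avoidInd, Finset.prod_boole, Set.mem_inter_iff, connAll, Set.mem_setOf_eq]
  by_cases hA : ω ∈ avoidAll ends s X <;> by_cases hC : ∀ v ∈ S, Conn ends ω s v <;>
    simp [hA, hC]


omit [Fintype E] [DecidableEq E] [Fintype V] [DecidableEq V] in
/-- The event `connAll ∅` is everything. -/
lemma connAll_empty : connAll ends s (∅ : Finset V) = Set.univ := by
  ext ω; simp [connAll]


omit [LinearOrder R] [IsStrictOrderedRing R] in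
/-- The two-copy sum in terms of one-copy probabilities. -/
theorem nestIID_eq (x y : V) (X Y : Finset V) :
    nestIID p ends s x y X Y =
      prob p (connAll ends s ({x} ∪ {y}) ∩ avoidAll ends s X) * prob p (avoidAll ends s Y) +
        prob p (avoidAll ends s X) * prob p (connAll ends s ({x} ∪ {y}) ∩ avoidAll ends s Y) -
        prob p (connAll ends s {x} ∩ avoidAll ends s X) *
          prob p (connAll ends s {y} ∩ avoidAll ends s Y) -
        prob p (connAll ends s {y} ∩ avoidAll ends s X) *
          prob p (connAll ends s {x} ∩ avoidAll ends s Y) := by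
  classical
  have hxy : ∀ Z : Finset V, prob p (connAll ends s ({x} ∪ {y}) ∩ avoidAll ends s Z) =
      ∑ ω : Config E, weight p ω * avoidInd ends s Z ω *
        (connInd ends s x ω * connInd ends s y ω) := by
    intro Z
    rw [← sum_weight_avoid_conn p ends s Z ({x} ∪ {y})]
    refine Finset.sum_congr rfl fun ω _ => ?_
    by_cases hxy' : x = y
    · subst hxy'
      rw [Finset.union_self, Finset.prod_singleton]
      unfold connInd
      split_ifs <;> ring
    · rw [Finset.prod_union (Finset.disjoint_singleton.2 hxy'), Finset.prod_singleton,
        Finset.prod_singleton]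
  have hx : ∀ Z : Finset V, prob p (connAll ends s {x} ∩ avoidAll ends s Z) =
      ∑ ω : Config E, weight p ω * avoidInd ends s Z ω * connInd ends s x ω := by
    intro Z
    rw [← sum_weight_avoid_conn p ends s Z {x}]
    simp only [Finset.prod_singleton]
  have hy : ∀ Z : Finset V, prob p (connAll ends s {y} ∩ avoidAll ends s Z) =
      ∑ ω : Config E, weight p ω * avoidInd ends s Z ω * connInd ends s y ω := by
    intro Z
    rw [← sum_weight_avoid_conn p ends s Z {y}]
    simp only [Finset.prod_singleton]
  have h0 : ∀ Z : Finset V, prob p (avoidAll ends s Z) =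
      ∑ ω : Config E, weight p ω * avoidInd ends s Z ω := by
    intro Z
    have := sum_weight_avoid_conn p ends s Z ∅
    rw [connAll_empty, Set.univ_inter] at this
    rw [← this]
    simp only [Finset.prod_empty, mul_one]
  rw [hxy, hxy, hx, hx, hy, hy, h0, h0]
  unfold nestIID
  simp only [Finset.sum_mul_sum, ← Finset.sum_add_distrib, ← Finset.sum_sub_distrib]
  refine Finset.sum_congr rfl fun ω _ => Finset.sum_congr rfl fun ω' _ => ?_
  ring

/-- **Nested avoidance for two independent clusters** (the all-`p` form of row 2′NEST): for
`X ⊆ Y`, `Σ_{ω,ω'} w(ω) w(ω') 1_{R_X}(ω) 1_{R_Y}(ω') (1[x∈C] − 1[x∈C'])(1[y∈C] − 1[y∈C']) ≥ 0`,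
by van den Berg–Kahn's inequality (`vdBK`). -/
theorem nestIID_nonneg (hp : IsProbVec p) (x y : V) {X Y : Finset V} (hXY : X ⊆ Y) :
    0 ≤ nestIID p ends s x y X Y := by
  classical
  rw [nestIID_eq]
  set P0 := prob p (avoidAll ends s X) with hP0
  set Q0 := prob p (avoidAll ends s Y) with hQ0
  set Px := prob p (connAll ends s {x} ∩ avoidAll ends s X) with hPx
  set Py := prob p (connAll ends s {y} ∩ avoidAll ends s X) with hPy
  set Pxy := prob p (connAll ends s ({x} ∪ {y}) ∩ avoidAll ends s X) with hPxy
  set Qx := prob p (connAll ends s {x} ∩ avoidAll ends s Y) with hQx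
  set Qy := prob p (connAll ends s {y} ∩ avoidAll ends s Y) with hQy
  set Qxy := prob p (connAll ends s ({x} ∪ {y}) ∩ avoidAll ends s Y) with hQxy
  -- conditional positive association given `R_X` and given `R_Y`
  have h1 : Px * Py ≤ Pxy * P0 := by
    have h := vdBK p hp ends s {x} {y} X X
    simpa only [Finset.inter_self, Finset.union_self] using h
  have h2 : Qx * Qy ≤ Qxy * Q0 := by
    have h := vdBK p hp ends s {x} {y} Y Y
    simpa only [Finset.inter_self, Finset.union_self] using h
  -- monotonicity in the avoided set (`X ⊆ Y`)
  have hYX : Y ∩ X = X := Finset.inter_eq_right.2 hXY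
  have hYX' : Y ∪ X = Y := Finset.union_eq_left.2 hXY
  have h3 : Qx * P0 ≤ Px * Q0 := by
    have h := vdBK p hp ends s {x} ∅ Y X
    simpa only [connAll_empty, Set.univ_inter, Finset.union_empty, hYX, hYX'] using h
  have h4 : Qy * P0 ≤ Py * Q0 := by
    have h := vdBK p hp ends s {y} ∅ Y X
    simpa only [connAll_empty, Set.univ_inter, Finset.union_empty, hYX, hYX'] using h
  -- nonnegativity and domination by the plain avoidance probabilities
  have hP0n : 0 ≤ P0 := prob_nonneg hp _
  have hQ0n : 0 ≤ Q0 := prob_nonneg hp _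
  have hPxn : 0 ≤ Px := prob_nonneg hp _
  have hPyn : 0 ≤ Py := prob_nonneg hp _
  have hQxn : 0 ≤ Qx := prob_nonneg hp _
  have hQyn : 0 ≤ Qy := prob_nonneg hp _
  have hPxyn : 0 ≤ Pxy := prob_nonneg hp _
  have hQxyn : 0 ≤ Qxy := prob_nonneg hp _
  have hPx0 : Px ≤ P0 := prob_mono hp Set.inter_subset_right
  have hPy0 : Py ≤ P0 := prob_mono hp Set.inter_subset_right
  have hPxy0 : Pxy ≤ P0 := prob_mono hp Set.inter_subset_right
  have hQx0 : Qx ≤ Q0 := prob_mono hp Set.inter_subset_right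
  have hQy0 : Qy ≤ Q0 := prob_mono hp Set.inter_subset_right
  have hQxy0 : Qxy ≤ Q0 := prob_mono hp Set.inter_subset_right
  rcases hP0n.lt_or_eq with hP0pos | hP0zero
  · rcases hQ0n.lt_or_eq with hQ0pos | hQ0zero
    · -- the main case: multiply through by `P0 * Q0 > 0`
      have key : 0 ≤ (Pxy * Q0 + P0 * Qxy - Px * Qy - Py * Qx) * (P0 * Q0) := by
        have h34 : 0 ≤ (Px * Q0 - P0 * Qx) * (Py * Q0 - P0 * Qy) :=
          mul_nonneg (by linarith) (by linarith)
        have h1' : Px * Py * (Q0 * Q0) ≤ Pxy * P0 * (Q0 * Q0) :=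
          mul_le_mul_of_nonneg_right h1 (mul_nonneg hQ0n hQ0n)
        have h2' : Qx * Qy * (P0 * P0) ≤ Qxy * Q0 * (P0 * P0) :=
          mul_le_mul_of_nonneg_right h2 (mul_nonneg hP0n hP0n)
        nlinarith [h34, h1', h2']
      exact nonneg_of_mul_nonneg_left key (mul_pos hP0pos hQ0pos)
    · -- `Q0 = 0`: every `Q`-term vanishes
      have hQx' : Qx = 0 := le_antisymm (hQ0zero ▸ hQx0) hQxn
      have hQy' : Qy = 0 := le_antisymm (hQ0zero ▸ hQy0) hQyn
      have hQxy' : Qxy = 0 := le_antisymm (hQ0zero ▸ hQxy0) hQxyn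
      rw [← hQ0zero, hQx', hQy', hQxy']; ring_nf; exact le_refl _
  · -- `P0 = 0`: every `P`-term vanishes
    have hPx' : Px = 0 := le_antisymm (hP0zero ▸ hPx0) hPxn
    have hPy' : Py = 0 := le_antisymm (hP0zero ▸ hPy0) hPyn
    have hPxy' : Pxy = 0 := le_antisymm (hP0zero ▸ hPxy0) hPxyn
    rw [← hP0zero, hPx', hPy', hPxy']; ring_nf; exact le_refl _

end NestIID

end Summit.Ventures.PercRepro2
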